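import Literature.NumberTheory.GaloisRepresentations.HochschildSerreEdgeTorsion
import Literature.NumberTheory.GaloisRepresentations.ContinuousCohomologyConnectingNaturality
import HarnessLib

/-!
# Naturality of the Hochschild–Serre edge in the coefficient module

For a profinite group `G`, a closed normal subgroup `N` and a morphism `φ : M → M'` of discrete
`G`-modules, the torsion-tolerant Hochschild–Serre edge of `HochschildSerreEdgeTorsion.lean`
commutes with the maps induced by `φ`:

  `H²(φ) ∘ hsEdgeTorsion_M = hsEdgeTorsion_{M'} ∘ H¹(G/N, H¹(N, φ))`

(`cohomologyMap_hsEdgeTorsion`).  Here `H¹(N, φ) : H¹(N, M) → H¹(N, M')` is a morphism of the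
discrete `G/N`-modules `hOneRep` (`hOneRepMap`: it commutes with the conjugation action), and the
proof assembles the naturality of the three constituents of the edge — the connecting map
`δ_N : Q^N ↠ H¹(N, M)` of the coinduced shift (`deltaNHom_hOneRepMap`, from `IsSES.cohomologyMap_δ₀`
over `N`), the inflation `Inf` (`cohomologyMap_infOne`) and `δ₁` (`IsSES.cohomologyMap_δ₁`) — along
the morphism of dimension-shifting sequences induced by `φ` (`ContinuousRep.coindHom`,
`coindQuotHom`).  This is the functoriality of the Hochschild–Serre spectral sequence in the
coefficients (NSW (2.4.1), (1.3.3)), in the one entry `E₂^{1,1} → H²` the tree has; it is what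
transports a compatible family of classes in `H¹(G/N, H¹(N, ℤ/lⁱ))` to a compatible family in
`H²(G, ℤ/lⁱ)` in the proof of [AbsTopI] Thm. 2.6 (iii) (S. Mochizuki, *Topics in Absolute
Anabelian Geometry I*, p. 23).

Classical, undisputed; nothing here bears on [IUTchIII] Cor. 3.12.

## References
* J. Neukirch, A. Schmidt, K. Wingberg, *Cohomology of Number Fields*, 2nd ed. (2008), (1.3.3),
  (2.4.1). [NeukirchSchmidtWingberg2008]
* J.-P. Serre, *Galois Cohomology* (1997), I §2.6 (b). [SerreGaloisCohomology1997]
-/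

noncomputable section

open CategoryTheory ContinuousCohomology Function

universe u

namespace Literature.NumberTheory.GaloisRepresentations

open _root_.TopRep _root_.Topology _root_.Filter
open Literature.NumberTheory.EllipticCurves (subgroupConj subgroupConj_apply_coe)

variable {G : Type u} [Group G] [TopologicalSpace G] [IsTopologicalGroup G] [CompactSpace G] [T2Space G]
  [TotallyDisconnectedSpace G]
variable (N : Subgroup G) [N.Normal] [hN : IsClosed (N : Set G)]
variable {M : Type u} [AddCommGroup M] [TopologicalSpace M] [DiscreteTopology M]
variable {M' : Type u} [AddCommGroup M'] [TopologicalSpace M'] [DiscreteTopology M']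
variable {ρ : ContinuousRep G ℤ M} {ρ' : ContinuousRep G ℤ M'}

/-! ### `H¹(N, φ)` as a morphism of the `G/N`-modules `H¹(N, M) → H¹(N, M')` -/

omit [CompactSpace G] [T2Space G] [TotallyDisconnectedSpace G] hN in
/-- The conjugation action on `H¹(N, –)` commutes with the map induced by a morphism of
`G`-modules: `σ_a ∘ H¹(N, φ) = H¹(N, φ) ∘ σ_a`. [cite: SerreGaloisCohomology1997, I §2.6] -/
theorem conjMap_cohomologyMap_restrictHom (φ : ρ.toTopRep ⟶ ρ'.toTopRep) (a : G)
    (x : continuousCohomology 1 ((ρ.restrict (subgroupIncl N)).toTopRep)) :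
    conjMap ρ'.toTopRep N a 1 (cohomologyMap (restrictHom N φ) 1 x) =
      cohomologyMap (restrictHom N φ) 1 (conjMap ρ.toTopRep N a 1 x) := by
  obtain ⟨c, rfl⟩ := oneCocycleClass_surjective _ x
  have e1 : conjMap ρ.toTopRep N a 1 (oneCocycleClass (ρ.restrict (subgroupIncl N)).toTopRep c) =
      oneCocycleClass (ρ.restrict (subgroupIncl N)).toTopRep
        (contOneCocycles.pullback (subgroupConj N a) (conjRepHom ρ.toTopRep N a) c) :=
    map_oneCocycleClass _ _ _ _
  rw [cohomologyMap_oneCocycleClass, e1, cohomologyMap_oneCocycleClass]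
  have e2 : conjMap ρ'.toTopRep N a 1 (oneCocycleClass (ρ'.restrict (subgroupIncl N)).toTopRep
        (contOneCocycles.pullback (ContinuousMonoidHom.id N) (resIdHom (restrictHom N φ)) c)) =
      oneCocycleClass (ρ'.restrict (subgroupIncl N)).toTopRep
        (contOneCocycles.pullback (subgroupConj N a) (conjRepHom ρ'.toTopRep N a)
          (contOneCocycles.pullback (ContinuousMonoidHom.id N) (resIdHom (restrictHom N φ)) c)) :=
    map_oneCocycleClass _ _ _ _
  rw [e2]
  refine congrArg _ (Subtype.ext (ContinuousMap.ext fun n => ?_))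
  change ρ' a (φ.hom (c.1 (subgroupConj N a n))) = φ.hom (ρ a (c.1 (subgroupConj N a n)))
  exact (ContinuousRep.hom_comm_apply φ a _).symm

omit [T2Space G] in
/-- The map `H¹(N, φ)` on the carriers `HOne` commutes with the `G/N`-actions of `hOneRep`.
[cite: SerreGaloisCohomology1997, I §2.6] -/
theorem hOneRep_smul_cohomologyMap (φ : ρ.toTopRep ⟶ ρ'.toTopRep) (a : G) (y : HOne N ρ) :
    HOne.of N ρ' (cohomologyMap (restrictHom N φ) 1
        ((HOne.of N ρ).symm (hOneRep N ρ (QuotientGroup.mk a) y))) =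
      hOneRep N ρ' (QuotientGroup.mk a)
        (HOne.of N ρ' (cohomologyMap (restrictHom N φ) 1 ((HOne.of N ρ).symm y))) := by
  rw [hOneRep_mk_apply, hOneRep_mk_apply, AddEquiv.symm_apply_apply, AddEquiv.symm_apply_apply,
    conjMap_cohomologyMap_restrictHom]

/-- **`H¹(N, φ) : H¹(N, M) → H¹(N, M')` as a morphism of discrete `G/N`-modules** (`hOneRep`,
conjugation action). [cite: SerreGaloisCohomology1997, I §2.6] -/
def hOneRepMap (φ : ρ.toTopRep ⟶ ρ'.toTopRep) : (hOneRep N ρ).toTopRep ⟶ (hOneRep N ρ').toTopRep :=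
  TopRep.ofHom
    ⟨⟨((HOne.of N ρ').toAddMonoidHom.comp
          ((cohomologyMap (restrictHom N φ) 1).hom.toLinearMap.toAddMonoidHom.comp
            (HOne.of N ρ).symm.toAddMonoidHom)).toIntLinearMap,
        continuous_of_discreteTopology⟩, by
      rintro ⟨a⟩
      ext y
      exact hOneRep_smul_cohomologyMap N φ a y⟩

omit [T2Space G] in
/-- Unfolding `hOneRepMap`: it is `H¹(N, φ)` on the carrier. [cite: SerreGaloisCohomology1997, I §2.6] -/
@[simp] theorem hOneRepMap_hom_apply (φ : ρ.toTopRep ⟶ ρ'.toTopRep) (y : HOne N ρ) :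
    (hOneRepMap N φ).hom y =
      HOne.of N ρ' (cohomologyMap (restrictHom N φ) 1 ((HOne.of N ρ).symm y)) := rfl

/-! ### Naturality of `δ_N : Q^N → H¹(N, M)` -/

section DeltaN

variable {M₁ : Type u} [AddCommGroup M₁] [TopologicalSpace M₁] [DiscreteTopology M₁]
variable {M₂ : Type u} [AddCommGroup M₂] [TopologicalSpace M₂] [DiscreteTopology M₂]
variable {M₃ : Type u} [AddCommGroup M₃] [TopologicalSpace M₃] [DiscreteTopology M₃]
variable {M₁' : Type u} [AddCommGroup M₁'] [TopologicalSpace M₁'] [DiscreteTopology M₁']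
variable {M₂' : Type u} [AddCommGroup M₂'] [TopologicalSpace M₂'] [DiscreteTopology M₂']
variable {M₃' : Type u} [AddCommGroup M₃'] [TopologicalSpace M₃'] [DiscreteTopology M₃']
variable {ρ₁ : ContinuousRep G ℤ M₁} {ρ₂ : ContinuousRep G ℤ M₂} {ρ₃ : ContinuousRep G ℤ M₃}
variable {ρ₁' : ContinuousRep G ℤ M₁'} {ρ₂' : ContinuousRep G ℤ M₂'} {ρ₃' : ContinuousRep G ℤ M₃'}
variable {f : ρ₁.toTopRep ⟶ ρ₂.toTopRep} {g : ρ₂.toTopRep ⟶ ρ₃.toTopRep}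
variable {f' : ρ₁'.toTopRep ⟶ ρ₂'.toTopRep} {g' : ρ₂'.toTopRep ⟶ ρ₃'.toTopRep}
variable {φ₁ : ρ₁.toTopRep ⟶ ρ₁'.toTopRep} {φ₂ : ρ₂.toTopRep ⟶ ρ₂'.toTopRep}
  {φ₃ : ρ₃.toTopRep ⟶ ρ₃'.toTopRep}

omit [T2Space G] in
/-- **Naturality of `δ_N`**: for a morphism of short exact sequences of discrete `G`-modules,
`H¹(N, φ₁) ∘ δ_N = δ_N' ∘ φ₃^N` on `M₃^N` (naturality of `δ₀` over `N`).
[cite: SerreGaloisCohomology1997, I §2.6] [cite: NeukirchSchmidtWingberg2008, (1.3.3)] -/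
theorem hOneRepMap_deltaNHom (h : IsSES f g) (h' : IsSES f' g')
    (hsq₁ : ∀ x, φ₂.hom (f.hom x) = f'.hom (φ₁.hom x))
    (hsq₂ : ∀ y, φ₃.hom (g.hom y) = g'.hom (φ₂.hom y))
    (v : ρ₃.invariantsOf N) :
    (hOneRepMap N φ₁).hom ((deltaNHom N h).hom v) =
      (deltaNHom N h').hom ((ContinuousRep.invariantsHom (N := N) φ₃).hom v) := by
  rw [deltaNHom_hom_apply, deltaNHom_hom_apply, deltaN_apply, deltaN_apply, hOneRepMap_hom_apply,
    AddEquiv.symm_apply_apply]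
  refine congrArg _ ?_
  rw [(h.restrictN (N := N)).cohomologyMap_δ₀ (h'.restrictN (N := N))
    (φ₁ := restrictHom N φ₁) (φ₂ := restrictHom N φ₂) (φ₃ := restrictHom N φ₃)
    (fun x => hsq₁ x) (fun y => hsq₂ y)]
  rfl

omit [T2Space G] in
/-- The same on cohomology: `H¹(G/N, H¹(N, φ₁)) ∘ H¹(δ_N) = H¹(δ_N') ∘ H¹(φ₃^N)`.
[cite: NeukirchSchmidtWingberg2008, (1.3.3)] -/
theorem cohomologyMap_hOneRepMap_deltaNHom (h : IsSES f g) (h' : IsSES f' g')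
    (hsq₁ : ∀ x, φ₂.hom (f.hom x) = f'.hom (φ₁.hom x))
    (hsq₂ : ∀ y, φ₃.hom (g.hom y) = g'.hom (φ₂.hom y))
    (y : continuousCohomology 1 (ρ₃.quotientInvariants N).toTopRep) :
    cohomologyMap (hOneRepMap N φ₁) 1 (cohomologyMap (deltaNHom N h) 1 y) =
      cohomologyMap (deltaNHom N h') 1 (cohomologyMap (ContinuousRep.invariantsHom (N := N) φ₃) 1 y) := by
  obtain ⟨c, rfl⟩ := oneCocycleClass_surjective _ y
  rw [cohomologyMap_oneCocycleClass, cohomologyMap_oneCocycleClass, cohomologyMap_oneCocycleClass,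
    cohomologyMap_oneCocycleClass]
  refine congrArg _ (Subtype.ext (ContinuousMap.ext fun q => ?_))
  rw [pullback_id_resIdHom_apply, pullback_id_resIdHom_apply, pullback_id_resIdHom_apply,
    pullback_id_resIdHom_apply]
  exact hOneRepMap_deltaNHom N h h' hsq₁ hsq₂ (c.1 q)

end DeltaN

/-! ### Naturality of the torsion-tolerant edge -/

/-- **Naturality of the Hochschild–Serre edge in the coefficients**: for a morphism `φ : M → M'` of
discrete `G`-modules (`G` profinite, `N` closed normal, `m` killing `H²(G/N, M^N)` and
`H²(G/N, M'^N)`, `H³(G/N, M^N) = H³(G/N, M'^N) = 0`),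
`H²(φ) (hsEdgeTorsion_M z) = hsEdgeTorsion_{M'} (H¹(G/N, H¹(N, φ)) z)`.
[cite: NeukirchSchmidtWingberg2008, (2.4.1)] [cite: SerreGaloisCohomology1997, I §2.6 (b)] -/
theorem cohomologyMap_hsEdgeTorsion (φ : ρ.toTopRep ⟶ ρ'.toTopRep) (m : ℕ)
    (hm : ∀ x : continuousCohomology 2 (ρ.quotientInvariants N).toTopRep, m • x = 0)
    (hm' : ∀ x : continuousCohomology 2 (ρ'.quotientInvariants N).toTopRep, m • x = 0)
    [Subsingleton (continuousCohomology 3 (ρ.quotientInvariants N).toTopRep)]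
    [Subsingleton (continuousCohomology 3 (ρ'.quotientInvariants N).toTopRep)]
    (z : continuousCohomology 1 (hOneRep N ρ).toTopRep) :
    cohomologyMap φ 2 (hsEdgeTorsion N ρ m hm z) =
      hsEdgeTorsion N ρ' m hm' (cohomologyMap (hOneRepMap N φ) 1 z) := by
  haveI := subsingleton_coind_restrict N ρ 0
  haveI := subsingleton_coind_invariants N ρ 0
  haveI := subsingleton_coind_invariants N ρ 1
  haveI := subsingleton_coind_restrict N ρ' 0
  haveI := subsingleton_coind_invariants N ρ' 0
  haveI := subsingleton_coind_invariants N ρ' 1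
  -- the morphism of dimension-shifting sequences induced by `φ`
  have hsq₁ : ∀ x, (ContinuousRep.coindHom φ).hom (ρ.coindι.hom x) = ρ'.coindι.hom (φ.hom x) :=
    ContinuousRep.coindι_coindHom φ
  have hsq₂ : ∀ F, (ContinuousRep.coindQuotHom φ).hom (ρ.coindπ.hom F) =
      ρ'.coindπ.hom ((ContinuousRep.coindHom φ).hom F) := ContinuousRep.coindπ_coindQuotHom φ
  -- a preimage `y` of `z` under `H¹(δ_N)` and its image `y'` in `H¹(G/N, Q'^N)`
  obtain ⟨y, hy⟩ := (isSES_coind ρ).exists_cohomologyMap_deltaNHom_eq N z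
  let y' : continuousCohomology 1 (ρ'.coindQuot.quotientInvariants N).toTopRep :=
    cohomologyMap (ContinuousRep.invariantsHom (N := N) (ContinuousRep.coindQuotHom φ)) 1 y
  have hTy' : cohomologyMap (deltaNHom N (isSES_coind ρ')) 1 y' =
      cohomologyMap (hOneRepMap N φ) 1 z := by
    have e := cohomologyMap_hOneRepMap_deltaNHom N (isSES_coind ρ) (isSES_coind ρ') hsq₁ hsq₂ y
    rw [hy] at e
    exact e.symm
  -- both edges on these representatives
  have e1 : hsEdgeTorsion N ρ m hm z = m • (isSES_coind ρ).δ₁ (infOne N _ y) := by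
    rw [← hy]
    exact (isSES_coind ρ).hsEdgeTorsion_cohomologyMap_deltaNHom N m hm y
  have e2 : hsEdgeTorsion N ρ' m hm' (cohomologyMap (hOneRepMap N φ) 1 z) =
      m • (isSES_coind ρ').δ₁ (infOne N _ y') := by
    rw [← hTy']
    exact (isSES_coind ρ').hsEdgeTorsion_cohomologyMap_deltaNHom N m hm' y'
  -- naturality of `Inf` and of `δ₁` along the morphism of shifts
  have e3 : infOne N _ y' = cohomologyMap (ContinuousRep.coindQuotHom φ) 1 (infOne N _ y) :=
    (cohomologyMap_infOne N (ContinuousRep.coindQuotHom φ) y).symm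
  have e4 : (isSES_coind ρ').δ₁ (cohomologyMap (ContinuousRep.coindQuotHom φ) 1 (infOne N _ y)) =
      cohomologyMap φ 2 ((isSES_coind ρ).δ₁ (infOne N _ y)) :=
    ((isSES_coind ρ).cohomologyMap_δ₁ (isSES_coind ρ') hsq₁ hsq₂ _).symm
  calc cohomologyMap φ 2 (hsEdgeTorsion N ρ m hm z)
      = cohomologyMap φ 2 (m • (isSES_coind ρ).δ₁ (infOne N _ y)) :=
        congrArg (fun t => cohomologyMap φ 2 t) e1
    _ = m • cohomologyMap φ 2 ((isSES_coind ρ).δ₁ (infOne N _ y)) := map_nsmul _ _ _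
    _ = m • (isSES_coind ρ').δ₁ (cohomologyMap (ContinuousRep.coindQuotHom φ) 1 (infOne N _ y)) :=
        congrArg (fun t => m • t) e4.symm
    _ = m • (isSES_coind ρ').δ₁ (infOne N _ y') :=
        congrArg (fun t => m • (isSES_coind ρ').δ₁ t) e3.symm
    _ = hsEdgeTorsion N ρ' m hm' (cohomologyMap (hOneRepMap N φ) 1 z) := e2.symm

end Literature.NumberTheory.GaloisRepresentations

end
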